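import Literature.NumberTheory.Rogawski1990.ArchInnerTransferCongruence   -- ★ (T-d) FILE 2 (F0P3a-p02): `archStableOrbitalIntegral_transport_archCongr`, `archStableOrbitalIntegral_transport_eq_of_isArchInnerTransfer`, `corresponds_archCongr_left_iff`
import Literature.NumberTheory.Automorphic.ArchDiagonalTorus             -- ★ `archDiagTorus`, `coe_archDiagTorus_eq_diagonal`, `isRegularElt_archDiagTorus_iff`
import HarnessLib

/-!
# (14.2.1) read at the regular torus points of the two DIAGONAL carriers: `Φ^st_{diag α′}(t_{α′} z, a′∘Φ′⁻¹; Φ′_* m′) = Φ^st_{diag β}(t_β z, a∘Φ_A⁻¹; (Φ_A)_* m)` for every regular `z`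
# ((R1-i-b): the hypothesis `hregΦ` of ★ (R1-i-a) from `IsArchInnerTransfer` after (T-d); Rogawski 1990 §14.2 (14.2.1) p. 232, §14.4 p. 237, §8.2 p. 124)

Topic `NumberTheory/Rogawski1990`; namespace `Literature.NumberTheory.Rogawski1990`.  THEOREMS ONLY (no `def`, no instance, no notation, no axiom, no named fact, no `sorry`).
Cell `pub/hodgecm-mathlib`, ENGINE T1 (crux H413 = `stmt-HodgeConjecture-24833`); floor-2 road «(J-nc) in-house», brick (R1-i-b) of R1 «(L-use) at all indefinite places» (LEAD F0P3a-plan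
(g9) WORD T8-119∕T8-120); author F0P3a-p07 (g8), 2026-09-01.

WHAT.  Given the inner transfer (14.2.1) `IsArchInnerTransfer L H′ m′ m a′ a` between `G′_∞ = U(H′)(L⁺ ⊗ ℝ)` and `G_∞ = U(Φ₃)(L⁺ ⊗ ℝ)`, and congruence isomorphisms acting by
conjugation `Φ′ : U(H′) ≃ₜ* U(diag α′)` (★ Landherr frame) and `Φ_A : U(Φ₃) ≃ₜ* U(diag β)` (★ `formCongr_quasiSplitFrame_diagonal`, `β = (½, 1, −½)`), the transported data satisfy, at
every REGULAR `z` (all `z_w` injective): **`archStableOrbitalIntegral_archDiagTorus_transport_eq_of_isArchInnerTransfer`** —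
`Φ^st_{diag α′}(t_{α′} z, a′ ∘ Φ′⁻¹; Φ′_* m′) = Φ^st_{diag β}(t_β z, a ∘ Φ_A⁻¹; (Φ_A)_* m)` — exactly the hypothesis `hregΦ` of ★-to-be (R1-i-a)
`prod_mul_archStableOrbitalIntegral_kottwitzSign_eq_of_archStableOrbitalIntegral_regular_eq` for the transported families and test functions.  Ingredients: the torus points
`t_{α′}(z)`, `t_β(z)` are THE SAME matrix of `GL₃(L ⊗ ℝ)` (`coe_archDiagTorus_eq_coe_archDiagTorus`, ★ `coe_archDiagTorus_eq_diagonal`), hence CORRESPOND (`corresponds_archDiagTorus`);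
`t_β(z)` is regular (★ `isRegularElt_archDiagTorus_iff`); ★ (T-d) FILE 2 transports both sides.
HONEST LABEL: HC_CM is proved only modulo the 7 printed citations until rung 0 closes; this file is book-keeping and pays nothing by itself.

## References
* [Rogawski1990] J. D. Rogawski, *Automorphic Representations of Unitary Groups in Three Variables*, Ann. of Math. Stud. 123 (1990), §14.2 (14.2.1) p. 232, §14.4 p. 237, §8.2 p. 124.
* [PlatonovRapinchuk1994] V. Platonov, A. Rapinchuk, *Algebraic Groups and Number Theory* (1994), §2.3.
-/

set_option autoImplicit false

noncomputable section

open MeasureTheory NumberField NumberField.InfinitePlace NumberField.mixedEmbedding Topology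
open Literature.NumberTheory.Automorphic Literature.NumberTheory.Automorphic.UnitaryGroup
open scoped Matrix MatrixGroups

namespace Literature.NumberTheory.Rogawski1990

section Torus

variable (L : Type) [Field L] [NumberField L] [IsCMField L] (N : ℕ) (α β : Fin N → L)

/-- **The torus points of two diagonal carriers with the same angles are THE SAME matrix of `GL_N(L ⊗ ℝ)`** (★ `coe_archDiagTorus_eq_diagonal`: `t(z) = diag(0, (z_{w,i})_w)` whatever
the weights). [cite: Rogawski1990, §8.2 p. 124] -/
theorem coe_archDiagTorus_eq_coe_archDiagTorus (z : {w : InfinitePlace L // IsComplex w} → Fin N → Circle) :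
    ((archDiagTorus L N α z : arch (↥(maximalRealSubfield L)) L (IsCMField.complexConj L) N (Matrix.diagonal α)) : GL (Fin N) (mixedSpace L)) =
      ((archDiagTorus L N β z : arch (↥(maximalRealSubfield L)) L (IsCMField.complexConj L) N (Matrix.diagonal β)) : GL (Fin N) (mixedSpace L)) :=
  Units.ext ((coe_archDiagTorus_eq_diagonal L N α z).trans (coe_archDiagTorus_eq_diagonal L N β z).symm)

/-- **Hence they CORRESPOND** (`γ′ ↔ γ`: conjugate in the common `GL_N(L ⊗ ℝ)` — here equal). [cite: Rogawski1990, §14.1 p. 232; §8.2 p. 124] -/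
theorem corresponds_archDiagTorus (z : {w : InfinitePlace L // IsComplex w} → Fin N → Circle) :
    Corresponds (UnitaryGroup.conjMixed (↥(maximalRealSubfield L)) L (IsCMField.complexConj L))
      (UnitaryGroup.archFormOf L N (Matrix.diagonal α)) (UnitaryGroup.archFormOf L N (Matrix.diagonal β))
      (archDiagTorus L N α z) (archDiagTorus L N β z) := by
  show IsConj _ _
  rw [coe_archDiagTorus_eq_coe_archDiagTorus L N α β z]

end Torus

section Transfer

variable (L : Type) [Field L] [NumberField L] [IsCMField L] (H' : Matrix (Fin 3) (Fin 3) L) (α' β : Fin 3 → L)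
  [∀ γ : UnitaryGroup.arch (↥(maximalRealSubfield L)) L (IsCMField.complexConj L) 3 H',
    MeasurableSpace (UnitaryGroup.arch (↥(maximalRealSubfield L)) L (IsCMField.complexConj L) 3 H' ⧸
      Subgroup.centralizer ({γ} : Set (UnitaryGroup.arch (↥(maximalRealSubfield L)) L (IsCMField.complexConj L) 3 H')))]
  [∀ γ : UnitaryGroup.arch (↥(maximalRealSubfield L)) L (IsCMField.complexConj L) 3 H',
    BorelSpace (UnitaryGroup.arch (↥(maximalRealSubfield L)) L (IsCMField.complexConj L) 3 H' ⧸
      Subgroup.centralizer ({γ} : Set (UnitaryGroup.arch (↥(maximalRealSubfield L)) L (IsCMField.complexConj L) 3 H')))]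
  [∀ γ : UnitaryGroup.arch (↥(maximalRealSubfield L)) L (IsCMField.complexConj L) 3 (Matrix.diagonal α'),
    MeasurableSpace (UnitaryGroup.arch (↥(maximalRealSubfield L)) L (IsCMField.complexConj L) 3 (Matrix.diagonal α') ⧸
      Subgroup.centralizer ({γ} : Set (UnitaryGroup.arch (↥(maximalRealSubfield L)) L (IsCMField.complexConj L) 3 (Matrix.diagonal α'))))]
  [∀ γ : UnitaryGroup.arch (↥(maximalRealSubfield L)) L (IsCMField.complexConj L) 3 (Matrix.diagonal α'),
    BorelSpace (UnitaryGroup.arch (↥(maximalRealSubfield L)) L (IsCMField.complexConj L) 3 (Matrix.diagonal α') ⧸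
      Subgroup.centralizer ({γ} : Set (UnitaryGroup.arch (↥(maximalRealSubfield L)) L (IsCMField.complexConj L) 3 (Matrix.diagonal α'))))]
  [∀ γ : UnitaryGroup.arch (↥(maximalRealSubfield L)) L (IsCMField.complexConj L) 3 (Matrix.of fun i j : Fin 3 => if i.val + j.val + 1 = 3 then (1 : L) else 0),
    MeasurableSpace (UnitaryGroup.arch (↥(maximalRealSubfield L)) L (IsCMField.complexConj L) 3 (Matrix.of fun i j : Fin 3 => if i.val + j.val + 1 = 3 then (1 : L) else 0) ⧸
      Subgroup.centralizer ({γ} : Set (UnitaryGroup.arch (↥(maximalRealSubfield L)) L (IsCMField.complexConj L) 3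
        (Matrix.of fun i j : Fin 3 => if i.val + j.val + 1 = 3 then (1 : L) else 0))))]
  [∀ γ : UnitaryGroup.arch (↥(maximalRealSubfield L)) L (IsCMField.complexConj L) 3 (Matrix.of fun i j : Fin 3 => if i.val + j.val + 1 = 3 then (1 : L) else 0),
    BorelSpace (UnitaryGroup.arch (↥(maximalRealSubfield L)) L (IsCMField.complexConj L) 3 (Matrix.of fun i j : Fin 3 => if i.val + j.val + 1 = 3 then (1 : L) else 0) ⧸
      Subgroup.centralizer ({γ} : Set (UnitaryGroup.arch (↥(maximalRealSubfield L)) L (IsCMField.complexConj L) 3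
        (Matrix.of fun i j : Fin 3 => if i.val + j.val + 1 = 3 then (1 : L) else 0))))]
  [∀ γ : UnitaryGroup.arch (↥(maximalRealSubfield L)) L (IsCMField.complexConj L) 3 (Matrix.diagonal β),
    MeasurableSpace (UnitaryGroup.arch (↥(maximalRealSubfield L)) L (IsCMField.complexConj L) 3 (Matrix.diagonal β) ⧸
      Subgroup.centralizer ({γ} : Set (UnitaryGroup.arch (↥(maximalRealSubfield L)) L (IsCMField.complexConj L) 3 (Matrix.diagonal β))))]
  [∀ γ : UnitaryGroup.arch (↥(maximalRealSubfield L)) L (IsCMField.complexConj L) 3 (Matrix.diagonal β),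
    BorelSpace (UnitaryGroup.arch (↥(maximalRealSubfield L)) L (IsCMField.complexConj L) 3 (Matrix.diagonal β) ⧸
      Subgroup.centralizer ({γ} : Set (UnitaryGroup.arch (↥(maximalRealSubfield L)) L (IsCMField.complexConj L) 3 (Matrix.diagonal β))))]

/-- **(R1-i-b) (14.2.1) AT THE REGULAR TORUS POINTS OF THE TWO DIAGONAL CARRIERS.**  For `hT : IsArchInnerTransfer L H′ m′ m a′ a` and congruence isomorphisms `Φ′ : U(H′) ≃ₜ* U(diag α′)`,
`Φ_A : U(Φ₃) ≃ₜ* U(diag β)` acting by `g ↦ T g T⁻¹`: at every regular `z`,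
`Φ^st_{diag α′}(t_{α′} z, a′ ∘ Φ′⁻¹; Φ′_* m′) = Φ^st_{diag β}(t_β z, a ∘ Φ_A⁻¹; (Φ_A)_* m)` — the `hregΦ` of ★ (R1-i-a) for the transported data.
[cite: Rogawski1990, §14.2 (14.2.1) p. 232; §14.4 p. 237; §8.2 p. 124] [cite: PlatonovRapinchuk1994, §2.3] -/
theorem archStableOrbitalIntegral_archDiagTorus_transport_eq_of_isArchInnerTransfer
    (T' : GL (Fin 3) (mixedSpace L))
    (Φ' : UnitaryGroup.arch (↥(maximalRealSubfield L)) L (IsCMField.complexConj L) 3 H' ≃ₜ*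
      UnitaryGroup.arch (↥(maximalRealSubfield L)) L (IsCMField.complexConj L) 3 (Matrix.diagonal α'))
    (hΦ' : ∀ g, ((Φ' g : UnitaryGroup.arch (↥(maximalRealSubfield L)) L (IsCMField.complexConj L) 3 (Matrix.diagonal α')) : GL (Fin 3) (mixedSpace L)) =
      T' * (g : GL (Fin 3) (mixedSpace L)) * T'⁻¹)
    (T_A : GL (Fin 3) (mixedSpace L))
    (Φ_A : UnitaryGroup.arch (↥(maximalRealSubfield L)) L (IsCMField.complexConj L) 3 (Matrix.of fun i j : Fin 3 => if i.val + j.val + 1 = 3 then (1 : L) else 0) ≃ₜ*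
      UnitaryGroup.arch (↥(maximalRealSubfield L)) L (IsCMField.complexConj L) 3 (Matrix.diagonal β))
    (hΦ_A : ∀ g, ((Φ_A g : UnitaryGroup.arch (↥(maximalRealSubfield L)) L (IsCMField.complexConj L) 3 (Matrix.diagonal β)) : GL (Fin 3) (mixedSpace L)) =
      T_A * (g : GL (Fin 3) (mixedSpace L)) * T_A⁻¹)
    {m' : OrbitalMeasureFamily (UnitaryGroup.arch (↥(maximalRealSubfield L)) L (IsCMField.complexConj L) 3 H')}
    {m : OrbitalMeasureFamily (UnitaryGroup.arch (↥(maximalRealSubfield L)) L (IsCMField.complexConj L) 3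
      (Matrix.of fun i j : Fin 3 => if i.val + j.val + 1 = 3 then (1 : L) else 0))}
    {a' : UnitaryGroup.arch (↥(maximalRealSubfield L)) L (IsCMField.complexConj L) 3 H' → ℂ}
    {a : UnitaryGroup.arch (↥(maximalRealSubfield L)) L (IsCMField.complexConj L) 3 (Matrix.of fun i j : Fin 3 => if i.val + j.val + 1 = 3 then (1 : L) else 0) → ℂ}
    (hT : IsArchInnerTransfer L H' m' m a' a)
    (z : {w : InfinitePlace L // IsComplex w} → Fin 3 → Circle) (hz : ∀ w, Function.Injective (z w)) :
    archStableOrbitalIntegral L 3 (Matrix.diagonal α') (m'.transport Φ'.toMulEquiv Φ'.continuous Φ'.symm.continuous) (a' ∘ Φ'.symm) (archDiagTorus L 3 α' z) =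
      archStableOrbitalIntegral L 3 (Matrix.diagonal β) (m.transport Φ_A.toMulEquiv Φ_A.continuous Φ_A.symm.continuous) (a ∘ Φ_A.symm) (archDiagTorus L 3 β z) := by
  obtain ⟨γ', hγ'⟩ : ∃ γ', Φ' γ' = archDiagTorus L 3 α' z := ⟨Φ'.symm _, Φ'.apply_symm_apply _⟩
  rw [← hγ', archStableOrbitalIntegral_transport_archCongr L T' Φ' hΦ' m' a' γ']
  symm
  refine archStableOrbitalIntegral_transport_eq_of_isArchInnerTransfer L T_A Φ_A hΦ_A hT γ' (archDiagTorus L 3 β z)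
    ((isRegularElt_archDiagTorus_iff L 3 β z).2 hz) ?_
  rw [← corresponds_archCongr_left_iff L T' Φ' hΦ' γ' (archDiagTorus L 3 β z), hγ']
  exact corresponds_archDiagTorus L 3 α' β z

end Transfer

end Literature.NumberTheory.Rogawski1990

end
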